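import Literature.AlgebraicTopology.SingularHomology.UniverseTransportOrientation
import Literature.Topology.FourManifolds.BordismFourNullBordism
import Literature.Topology.FourManifolds.SignatureBordismInvariance
import Literature.Topology.FourManifolds.ManifoldULift
import Literature.Topology.FourManifolds.GluckTwistMeridian
import Literature.Topology.FourManifolds.IntersectionLattice
import Mathlib.Topology.Instances.Shrink
import HarnessLib

/-!
# The `Ω₄^SO ≅ ℤ` cluster at universe `0` implies it at every universe

Topic `Literature/Topology/FourManifolds` (fact seat
`provefact-Literature.Topology.FourManifolds.isOrie-a424d30787`, the named fact
`Literature.Topology.FourManifolds.isOrientedBordant_of_isEmpty_of_signature_eq_zero`: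
R. Kirby, *The Topology of 4-Manifolds*, LNM 1374 (1989), Cor. IX.2, "if `σ(M) = 0`, then `M`
bounds an oriented 5-manifold").  The three open named facts of the cluster —
`isOrientedBordant_of_isEmpty_of_signature_eq_zero` (Kirby, Cor. IX.2),
`isOrientedBordant_of_signature_eq` (Thom 1954, Thm IV.13: injectivity of `τ : Ω⁴ → ℤ`) and
`isOrientedBordant_iff_signature_eq` (`spc4.S36`) — quantify over closed smooth 4-manifolds
`M : Type u` in an arbitrary universe, whereas every engine of the tree that could prove them
(the concrete models `ℂℙ²`, spheres and discs, the connected-sum and boundary-connected-sum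
toolkits, Lefschetz/Poincaré duality engines, handle theory) lives in `Type`.  This file closes
that gap once and for all: **each of the three facts at universe `0` implies the same fact at
every universe `u`**.

The argument is the standard transport ([folklore]; the same pattern as
`SmaleHomologySpheresUniverse.lean`, `BordismFourDuality.lean`): a closed manifold `M : Type u`
is small (`small_of_compactSpace_chartedSpace`), so `Shrink.{0} M : Type` with the transported
`C^∞` structure (`Homeomorph.transportChartedSpace`, `Homeomorph.transportDiffeomorph`,
`GluckTwistMeridian.lean`) is a diffeomorphic copy; the `ℤ`-orientation `μ` transports to the
copy with corresponding local classes and **the same signature** (the intersection forms are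
isometric across universes, `equivalent_intersectionForm_of_xEquiv` of
`…UniverseTransportOrientation`); the copy bounds by the universe-`0` fact; and **an oriented
bordism in `Type` lifts along diffeomorphisms of its ends to any universe**
(`IsOrientedBordant.of_diffeomorph_univ`: total space `ULift W₀` with the lifted charts of
`ManifoldULift.lean`, the relative class transported by `relativeSingularHomology.xEquiv`, its
boundary formula `∂w = (inl)_*[M] − (inr)_*[N]` by the naturality of `∂`, of induced maps and
of fundamental classes across universes).

* `signature_eq_of_xEquiv` — `σ(X, μ') = σ(Y, μ)` for orientations corresponding along a
  homeomorphism `X ≃ₜ Y` across universes (Gompf–Stipsicz 1999, §1.2);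
* `IsOrientedBordant.of_diffeomorph_univ` — the lift of an oriented bordism datum;
* `isOrientedBordant_of_isEmpty_of_signature_eq_zero_of_univ_zero` — **Kirby's Cor. IX.2 at
  universe `0` implies it at universe `u`**;
* `isOrientedBordant_of_signature_eq_of_univ_zero`, `isOrientedBordant_iff_signature_eq_of_univ_zero`
  — the same for Thom's Thm IV.13 and for `spc4.S36` (through the proved equivalences
  `isOrientedBordant_of_signature_eq_iff_isEmpty`, `isOrientedBordant_iff_signature_eq_iff_isEmpty`
  of `BordismFourNullBordism.lean` and Thom's Thm IV.1 `signature_eq_of_isOrientedBordant_holds`,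
  a theorem in every universe).

Everything here is proved; no definition and no named fact is introduced.  The facts themselves
remain open: what is reduced is only their universe polymorphism.

## References

* R. C. Kirby, *The Topology of 4-Manifolds*, LNM 1374, Springer 1989, Ch. IX, Cor. 2 and its
  proof ("if `σ(M) = 0`, then `M` bounds an oriented 5-manifold"; held copy
  `lit read book:kirby1989-topology-4-manifolds`, chunk p0052). [Kirby1989]
* R. Thom, *Quelques propriétés globales des variétés différentiables*, Comment. Math. Helv. 28
  (1954), Thm IV.13. [ThomCMH1954]
* J. Milnor, J. Stasheff, *Characteristic Classes*, Ann. of Math. Studies 76 (1974), §17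
  p. 200 (oriented cobordism). [MilnorStasheffAMS76]
* R. E. Gompf, A. I. Stipsicz, *4-Manifolds and Kirby Calculus*, GSM 20 (1999), §1.2.
  [GompfStipsiczGSM1999]
* A. Hatcher, *Algebraic Topology*, CUP 2002, §2.1, Thm. 3.26. [HatcherAT2002]
-/

noncomputable section

-- as in `…UniverseTransportIso` / `…UniverseTransportOrientation` (whose lemmas are rewritten with
-- here): chains of the concrete complex are `Finsupp`s up to unfolding of semireducible definitions
set_option backward.isDefEq.respectTransparency false

open scoped Manifold ContDiff Topology
open Set Function
open Literature.AlgebraicTopology.SingularHomology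

namespace Literature.Topology.FourManifolds

universe u v

/-! ### The signature across universes -/

/-- **The signature of a closed oriented `4`-manifold is invariant under homeomorphisms across
universes respecting the orientations**: if the `ℤ`-orientations `μ'` of `X` and `μ` of `Y`
correspond along `e : X ≃ₜ Y`, then `σ(X, μ') = σ(Y, μ)` (Gompf–Stipsicz 1999, §1.2: `Q_X`,
and with it `σ(X)`, is an invariant of the oriented homeomorphism type; Milnor–Husemoller 1973,
§II.2 and §V.1). [cite: GompfStipsiczGSM1999, §1.2] -/
theorem signature_eq_of_xEquiv {X : Type u} {Y : Type v} [TopologicalSpace X] [TopologicalSpace Y]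
    [CompactSpace X] [T2Space X] [ChartedSpace (EuclideanSpace ℝ (Fin 4)) X]
    [CompactSpace Y] [T2Space Y] [ChartedSpace (EuclideanSpace ℝ (Fin 4)) Y] (e : X ≃ₜ Y)
    {μ' : HomologicalOrientation ℤ X 4} {μ : HomologicalOrientation ℤ Y 4}
    (hμ : ∀ x, localHomology.xEquiv ℤ ℤ e x 4 (μ'.localClass x) = μ.localClass (e x)) :
    μ'.signature = μ.signature :=
  LinearMap.BilinForm.signature_eq_of_equivalent
    (equivalent_intersectionForm_of_xEquiv e hμ two_add_two_eq_four)

/-! ### Oriented bordism across universes -/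

section Transport

variable {n : ℕ}
  {M₀ N₀ : Type} [TopologicalSpace M₀] [ChartedSpace (EuclideanSpace ℝ (Fin n)) M₀]
  [TopologicalSpace N₀] [ChartedSpace (EuclideanSpace ℝ (Fin n)) N₀]
  {M N : Type u} [TopologicalSpace M] [ChartedSpace (EuclideanSpace ℝ (Fin n)) M]
  [TopologicalSpace N] [ChartedSpace (EuclideanSpace ℝ (Fin n)) N]

/-- **An oriented bordism in `Type` lifts along diffeomorphisms of its ends to an oriented
bordism in any universe.**  Let `Φ : M₀ ≅ M`, `Ψ : N₀ ≅ N` be diffeomorphisms from closed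
manifolds `M₀, N₀ : Type` onto closed manifolds `M, N : Type u`, and let the `ℤ`-orientations
`μ₀ ↔ μ`, `ν₀ ↔ ν` correspond along them.  If `(M₀, μ₀) ∼ (N₀, ν₀)` through `(W₀, w₀)`, then
`(M, μ) ∼ (N, ν)` through `W = ULift W₀` (the lifted charts, `ManifoldULift.lean`) with ends
`up ∘ inl ∘ Φ⁻¹`, `up ∘ inr ∘ Ψ⁻¹` and the class `w` corresponding to `w₀` under
`H₍ₙ₊₁₎(W₀, ∂W₀) ≃ H₍ₙ₊₁₎(W, ∂W)` (`relativeSingularHomology.xEquiv`): the boundary formula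
`∂w = (inl)_*[M] − (inr)_*[N]` is transported by the naturality of `∂`
(`relativeSingularHomology.xEquiv_δ`), of induced maps (`singularHomology.xEquiv_map`) and of
fundamental classes (`singularHomology.xEquiv_fundamentalClass`) under the comparison
equivalences across universes (Hatcher 2002, §2.1 and Thm. 3.26; Milnor–Stasheff 1974, §17
p. 200 for the notion). [cite: MilnorStasheffAMS76, §17 p. 200] -/
theorem IsOrientedBordant.of_diffeomorph_univ [IsManifold (𝓡 n) ∞ M₀] [IsManifold (𝓡 n) ∞ N₀]
    [CompactSpace M₀] [T2Space M₀] [CompactSpace N₀] [T2Space N₀]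
    [IsManifold (𝓡 n) ∞ M] [IsManifold (𝓡 n) ∞ N]
    [CompactSpace M] [T2Space M] [CompactSpace N] [T2Space N]
    (Φ : M₀ ≃ₘ⟮𝓡 n, 𝓡 n⟯ M) (Ψ : N₀ ≃ₘ⟮𝓡 n, 𝓡 n⟯ N)
    {μ₀ : HomologicalOrientation ℤ M₀ n} {ν₀ : HomologicalOrientation ℤ N₀ n}
    {μ : HomologicalOrientation ℤ M n} {ν : HomologicalOrientation ℤ N n}
    (hμ : ∀ x, localHomology.xEquiv ℤ ℤ Φ.toHomeomorph x n (μ₀.localClass x) = μ.localClass (Φ x))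
    (hν : ∀ y, localHomology.xEquiv ℤ ℤ Ψ.toHomeomorph y n (ν₀.localClass y) = ν.localClass (Ψ y))
    (h : IsOrientedBordant n μ₀ ν₀) : IsOrientedBordant n μ ν := by
  obtain ⟨c₀, w₀, hw₀⟩ := h
  -- the lifted total space and the lifted ends
  let W : Type u := ULift.{u} c₀.W
  have hbd : (𝓡∂ (n + 1)).boundary W = ULift.down ⁻¹' (𝓡∂ (n + 1)).boundary c₀.W :=
    ManifoldULift.boundary_eq
  have hinl : Manifold.IsSmoothEmbedding (𝓡 n) (𝓡∂ (n + 1)) ∞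
      (fun x : M => ULift.up.{u} (c₀.inl (Φ.symm x))) :=
    ((c₀.isSmoothEmbedding_inl.comp_diffeomorph Φ.symm).diffeomorph_comp
      (ManifoldULift.diffeomorph (𝓡∂ (n + 1)) c₀.W ∞).symm :)
  have hinr : Manifold.IsSmoothEmbedding (𝓡 n) (𝓡∂ (n + 1)) ∞
      (fun y : N => ULift.up.{u} (c₀.inr (Ψ.symm y))) :=
    ((c₀.isSmoothEmbedding_inr.comp_diffeomorph Ψ.symm).diffeomorph_comp
      (ManifoldULift.diffeomorph (𝓡∂ (n + 1)) c₀.W ∞).symm :)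
  let c : Cobordism n M N :=
    { W := W
      inl := fun x => ULift.up (c₀.inl (Φ.symm x))
      inr := fun y => ULift.up (c₀.inr (Ψ.symm y))
      isSmoothEmbedding_inl := hinl
      isSmoothEmbedding_inr := hinr
      disjoint_range := by
        refine disjoint_left.2 ?_
        rintro _ ⟨x, rfl⟩ ⟨y, hy⟩
        have h' : c₀.inr (Ψ.symm y) = c₀.inl (Φ.symm x) := congrArg ULift.down hy
        exact (disjoint_left.1 c₀.disjoint_range) (mem_range_self (Φ.symm x)) ⟨Ψ.symm y, h'⟩
      range_inl_union_range_inr := by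
        rw [hbd]
        ext z
        simp only [mem_union, mem_range, mem_preimage]
        rw [← c₀.range_inl_union_range_inr, mem_union, mem_range, mem_range]
        constructor
        · rintro (⟨x, rfl⟩ | ⟨y, rfl⟩)
          · exact Or.inl ⟨Φ.symm x, rfl⟩
          · exact Or.inr ⟨Ψ.symm y, rfl⟩
        · rintro (⟨x, hx⟩ | ⟨y, hy⟩)
          · exact Or.inl ⟨Φ x, by rw [Diffeomorph.symm_apply_apply, ← ULift.up_down z, ← hx]⟩
          · exact Or.inr ⟨Ψ y, by rw [Diffeomorph.symm_apply_apply, ← ULift.up_down z, ← hy]⟩ }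
  -- the homeomorphism `W₀ ≃ W` of pairs and its restriction to the boundaries
  let e : c₀.W ≃ₜ W := Homeomorph.ulift.symm
  have hAB : MapsTo e ((𝓡∂ (n + 1)).boundary c₀.W) ((𝓡∂ (n + 1)).boundary W) := by
    intro z hz; rw [hbd]; exact hz
  have hBA : MapsTo e.symm ((𝓡∂ (n + 1)).boundary W) ((𝓡∂ (n + 1)).boundary c₀.W) := by
    intro z hz; rw [hbd] at hz; exact hz
  let eA : ↥((𝓡∂ (n + 1)).boundary c₀.W) ≃ₜ ↥((𝓡∂ (n + 1)).boundary W) :=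
    e.subtype (fun z => by rw [hbd]; exact Iff.rfl)
  have heA : ∀ a : ↥((𝓡∂ (n + 1)).boundary c₀.W), (eA a : W) = e a := fun a => rfl
  -- the ends of `W` and `W₀` correspond along `Φ`, `Ψ`
  have hsq₁ : ∀ x, c.inlBoundary (Φ.toHomeomorph x) = eA (c₀.inlBoundary x) := fun x =>
    Subtype.ext (by
      change ULift.up (c₀.inl (Φ.symm (Φ x))) = ULift.up (c₀.inl x)
      rw [Diffeomorph.symm_apply_apply])
  have hsq₂ : ∀ y, c.inrBoundary (Ψ.toHomeomorph y) = eA (c₀.inrBoundary y) := fun y =>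
    Subtype.ext (by
      change ULift.up (c₀.inr (Ψ.symm (Ψ y))) = ULift.up (c₀.inr y)
      rw [Diffeomorph.symm_apply_apply])
  -- the transported class and its boundary
  refine ⟨c, relativeSingularHomology.xEquiv ℤ ℤ e hAB hBA (n + 1) w₀, ?_⟩
  rw [← relativeSingularHomology.xEquiv_δ ℤ ℤ e hAB hBA eA heA n w₀, hw₀, map_sub,
    singularHomology.xEquiv_map ℤ ℤ Φ.toHomeomorph eA c₀.inlBoundary c.inlBoundary hsq₁ n,
    singularHomology.xEquiv_map ℤ ℤ Ψ.toHomeomorph eA c₀.inrBoundary c.inrBoundary hsq₂ n,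
    singularHomology.xEquiv_fundamentalClass ℤ Φ.toHomeomorph hμ,
    singularHomology.xEquiv_fundamentalClass ℤ Ψ.toHomeomorph hν]

end Transport

/-! ### The `Ω₄^SO ≅ ℤ` cluster: universe `0` implies every universe -/

/-- **Kirby's Cor. IX.2 at universe `0` implies it at every universe.**  If every closed
oriented smooth `4`-manifold `M₀ : Type` of signature zero is an oriented boundary, then so is
every closed oriented smooth `4`-manifold `M : Type u` of signature zero: `M` is compact, hence
small, so `Shrink.{0} M : Type` with the transported smooth structure
(`Homeomorph.transportChartedSpace`, `Homeomorph.transportDiffeomorph`) is a diffeomorphic copy;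
its `ℤ`-orientation corresponding to `μ` (`HomologicalOrientation.exists_xEquiv_localClass_eq`)
has the same signature (`signature_eq_of_xEquiv`), so the copy bounds, and the null-bordism lifts
back (`IsOrientedBordant.of_diffeomorph_univ`, with the empty end `PEmpty`).
[cite: Kirby1989, Cor. IX.2] -/
theorem isOrientedBordant_of_isEmpty_of_signature_eq_zero_of_univ_zero
    (h : isOrientedBordant_of_isEmpty_of_signature_eq_zero.{0}) :
    isOrientedBordant_of_isEmpty_of_signature_eq_zero.{u} := by
  intro M N _ _ _ _ _ _ _ _ _ _ _ _ _ μ ν hσ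
  -- a copy of `M` in `Type`
  haveI : Small.{0} M := small_of_compactSpace_chartedSpace (X := M) (EuclideanSpace ℝ (Fin 4))
  let φ : M ≃ₜ Shrink.{0} M := Shrink.homeomorph M
  letI : ChartedSpace (EuclideanSpace ℝ (Fin 4)) (Shrink.{0} M) :=
    Homeomorph.transportChartedSpace (H := EuclideanSpace ℝ (Fin 4)) φ
  haveI : IsManifold (𝓡 4) ∞ (Shrink.{0} M) :=
    Homeomorph.isManifold_transportChartedSpace (I₀ := 𝓡 4) (n := ∞) φ
  haveI : T2Space (Shrink.{0} M) := φ.t2Space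
  haveI : CompactSpace (Shrink.{0} M) := φ.compactSpace
  haveI : SecondCountableTopology (Shrink.{0} M) := φ.symm.secondCountableTopology
  let Φ : Shrink.{0} M ≃ₘ⟮𝓡 4, 𝓡 4⟯ M :=
    (Homeomorph.transportDiffeomorph (I₀ := 𝓡 4) (n := ∞) φ).symm
  -- the empty end in `Type`
  letI : ChartedSpace (EuclideanSpace ℝ (Fin 4)) PEmpty.{1} := ChartedSpace.empty _ _
  let Ψ : PEmpty.{1} ≃ₘ⟮𝓡 4, 𝓡 4⟯ N :=
    { toEquiv := Equiv.equivOfIsEmpty _ _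
      contMDiff_toFun := fun x => isEmptyElim x
      contMDiff_invFun := fun y => isEmptyElim y }
  -- the corresponding orientations
  obtain ⟨μ₀, hμ₀⟩ := HomologicalOrientation.exists_xEquiv_localClass_eq (R := ℤ) Φ.toHomeomorph μ
  obtain ⟨ν₀, hν₀⟩ := HomologicalOrientation.exists_xEquiv_localClass_eq (R := ℤ) Ψ.toHomeomorph ν
  have hσ₀ : μ₀.signature = 0 := by rw [signature_eq_of_xEquiv Φ.toHomeomorph hμ₀, hσ]
  exact IsOrientedBordant.of_diffeomorph_univ Φ Ψ hμ₀ hν₀ (h μ₀ ν₀ hσ₀)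

/-- **Thom's Thm IV.13 (injectivity of `τ`, two-ended form) at universe `0` implies it at every
universe**, through the proved equivalence with Kirby's Cor. IX.2 at each universe
(`isOrientedBordant_of_signature_eq_iff_isEmpty`). [cite: ThomCMH1954, Thm IV.13] -/
theorem isOrientedBordant_of_signature_eq_of_univ_zero
    (h : isOrientedBordant_of_signature_eq.{0}) : isOrientedBordant_of_signature_eq.{u} :=
  isOrientedBordant_of_signature_eq_of_isEmpty
    (isOrientedBordant_of_isEmpty_of_signature_eq_zero_of_univ_zero
      (isOrientedBordant_of_isEmpty_of_signature_eq_zero_of h))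

/-- **`spc4.S36` (`Ω₄^SO ↪ ℤ` via the signature: `(M, μ) ∼ (N, ν) ↔ σ(M, μ) = σ(N, ν)`) at
universe `0` implies it at every universe**: the forward direction is Thom's Thm IV.1, a theorem
of the tree in every universe (`signature_eq_of_isOrientedBordant_holds`); the converse is
transported by `isOrientedBordant_of_signature_eq_of_univ_zero`. [cite: ThomCMH1954, Thm IV.13] -/
theorem isOrientedBordant_iff_signature_eq_of_univ_zero
    (h : isOrientedBordant_iff_signature_eq.{0}) : isOrientedBordant_iff_signature_eq.{u} :=
  isOrientedBordant_iff_signature_eq_iff_isEmpty.2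
    ⟨signature_eq_of_isOrientedBordant_holds,
      isOrientedBordant_of_isEmpty_of_signature_eq_zero_of_univ_zero
        (isOrientedBordant_iff_signature_eq_iff_isEmpty.1 h).2⟩

end Literature.Topology.FourManifolds

end
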